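import Literature.AnabelianGeometry.SemiGraphs.CoveringHomCanonical
import Literature.AnabelianGeometry.SemiGraphs.BObjFunctors
import Literature.AnabelianGeometry.SemiGraphs.PullbackFunctor
import Literature.AnabelianGeometry.SemiGraphs.GraphOfAnabelioidsLimits

/-!
# The comparison functor `B(𝒢)_{/A} ⥤ B(𝒢_A)` ([SemiAnbd] Def. 2.2 (i), global clause — brick G4)

Mochizuki, *Semi-graphs of anabelioids*, Publ. RIMS **42** (2006) 221–322, §2 p. 23
[cite: MochizukiSemiAnbd2006, Def. 2.2(i) p.23]: a finite étale covering `B' = B(𝒢)_{G'} → B(𝒢)`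
"arises naturally as the `B(−)` of some semi-graph of anabelioids `𝒢'`", i.e. `B(𝒢') ≃ B(𝒢)_{/A}`
(`A = G'`) compatibly with the pull-back functor — the cell's `Hom.IsBObjCoveringOf`
(`FiniteEtaleCoveringGlobal.lean`, abc-iut-L3-d3).  For the covering `𝒢_A → 𝒢` constructed in
`CoveringOfObject.lean` this file and its sequel `CoveringComparison.lean` build the comparison functor
`BObj.toCovering A : Over A ⥤ B(𝒢_A)`.  Here: the general machinery for functors into `B(𝒢_A)`
whose components factor through the component anabelioids `Over P` — `liftOver`, `liftOverIso`
(the constituents of `𝒢_A` being the models `Shrink (Over P)`, this isolates the transport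
`Over P ≌ Shrink (Over P)` once, so that all later coherence conditions are checked in `Over P`,
`Over Q`); the gluing functors `gluingAt` with their projection formulas; `B(𝒢)` has binary
products (`hasBinaryProducts_bObj`, from abc-iut-L3-t9's componentwise limits — the instance the
global clause quantifies over) and the `ρ` preserve them.
-/

namespace Literature.AnabelianGeometry.SemiGraphs

namespace SemiGraphOfAnabelioids

open CategoryTheory CategoryTheory.Limits CategoryTheory.PreGaloisCategory
open Literature.AnabelianGeometry.Anabelioids

universe w' w v₁ u₁ u

-- Mathlib's `Over.pullback` / `Over.star` simp lemmas (`pullback.lift_fst`, …) only fire under the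
-- pre-v4.2x defeq transparency behaviour, exactly as in `Mathlib/CategoryTheory/Comma/Over/Pullback.lean`.
set_option backward.isDefEq.respectTransparency false

/-! ### Binary products in `B(𝒢)` -/

/-- `B(𝒢)` has binary products (computed componentwise; the `b^*` are left exact).
[cite: MochizukiSemiAnbd2006, Def. 2.1 p.23] -/
theorem hasBinaryProducts_bObj (𝒢 : SemiGraphOfAnabelioids.{v₁, u₁, u}) : HasBinaryProducts 𝒢.BObj := by
  haveI : ∀ (b : 𝒢.graph.Branch) (v : 𝒢.graph.Vertex) (h : 𝒢.graph.abuts b = some v),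
      PreservesLimitsOfShape (Discrete WalkingPair) (𝒢.pull b v h).pullback := fun b v h => by
    haveI : PreservesFiniteLimits (𝒢.pull b v h).pullback := (𝒢.pull b v h).property.1
    infer_instance
  exact (𝒢.hasLimitsOfShape_bObj (J := Discrete WalkingPair)).1

/-- The restriction functors `ρ_v : B(𝒢) ⥤ 𝒢_v` preserve binary products.
[cite: MochizukiSemiAnbd2006, Def. 2.1 p.23] -/
theorem preservesBinaryProducts_ρ (𝒢 : SemiGraphOfAnabelioids.{v₁, u₁, u}) (v : 𝒢.graph.Vertex) :
    PreservesLimitsOfShape (Discrete WalkingPair) (𝒢.ρ v) := by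
  haveI : ∀ (b : 𝒢.graph.Branch) (v : 𝒢.graph.Vertex) (h : 𝒢.graph.abuts b = some v),
      PreservesLimitsOfShape (Discrete WalkingPair) (𝒢.pull b v h).pullback := fun b v h => by
    haveI : PreservesFiniteLimits (𝒢.pull b v h).pullback := (𝒢.pull b v h).property.1
    infer_instance
  exact (𝒢.hasLimitsOfShape_bObj (J := Discrete WalkingPair)).2.1 v

/-- The restriction functors `ρ_e : B(𝒢) ⥤ 𝒢_e` preserve binary products.
[cite: MochizukiSemiAnbd2006, Def. 2.1 p.23] -/
theorem preservesBinaryProducts_ρE (𝒢 : SemiGraphOfAnabelioids.{v₁, u₁, u}) (e : 𝒢.graph.Edge) :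
    PreservesLimitsOfShape (Discrete WalkingPair) (𝒢.ρE e) := by
  haveI : ∀ (b : 𝒢.graph.Branch) (v : 𝒢.graph.Vertex) (h : 𝒢.graph.abuts b = some v),
      PreservesLimitsOfShape (Discrete WalkingPair) (𝒢.pull b v h).pullback := fun b v h => by
    haveI : PreservesFiniteLimits (𝒢.pull b v h).pullback := (𝒢.pull b v h).property.1
    infer_instance
  exact (𝒢.hasLimitsOfShape_bObj (J := Discrete WalkingPair)).2.2 e

/-- `ρ_v` on objects. [cite: MochizukiSemiAnbd2006, Def. 2.1 p.23] -/
@[simp] theorem ρ_obj (𝒢 : SemiGraphOfAnabelioids.{v₁, u₁, u}) (v : 𝒢.graph.Vertex) (X : 𝒢.BObj) :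
    (𝒢.ρ v).obj X = X.S v := rfl

/-- `ρ_v` on morphisms. [cite: MochizukiSemiAnbd2006, Def. 2.1 p.23] -/
@[simp] theorem ρ_map (𝒢 : SemiGraphOfAnabelioids.{v₁, u₁, u}) (v : 𝒢.graph.Vertex) {X Y : 𝒢.BObj}
    (f : X ⟶ Y) : (𝒢.ρ v).map f = f.fS v := rfl

/-- `ρ_e` on objects. [cite: MochizukiSemiAnbd2006, Def. 2.1 p.23] -/
@[simp] theorem ρE_obj (𝒢 : SemiGraphOfAnabelioids.{v₁, u₁, u}) (e : 𝒢.graph.Edge) (X : 𝒢.BObj) :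
    (𝒢.ρE e).obj X = X.T e := rfl

/-- `ρ_e` on morphisms. [cite: MochizukiSemiAnbd2006, Def. 2.1 p.23] -/
@[simp] theorem ρE_map (𝒢 : SemiGraphOfAnabelioids.{v₁, u₁, u}) (e : 𝒢.graph.Edge) {X Y : 𝒢.BObj}
    (f : X ⟶ Y) : (𝒢.ρE e).map f = f.fT e := rfl

namespace BObj

variable {𝒢 : SemiGraphOfAnabelioids.{v₁, u₁, u}} (A : 𝒢.BObj)

/-! ### The models of the component anabelioids and the gluing functors of `𝒢_A` -/

/-- `Over P ⥤ (𝒢_A)_{(v,P)}`: the equivalence onto the model. [cite: MochizukiSemiAnbd2006, Def. 2.2(i) p.23] -/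
noncomputable def toV (vc : A.fibreData.total.Vertex) :
    Over ((A.vComp vc).1 : 𝒢.V (A.fibreData.proj.vertexMap vc)) ⥤ A.VModel vc :=
  (Shrink.equivalence (Over ((A.vComp vc).1 : 𝒢.V (A.fibreData.proj.vertexMap vc)))).functor

/-- `(𝒢_A)_{(v,P)} ⥤ Over P`: the inverse equivalence. [cite: MochizukiSemiAnbd2006, Def. 2.2(i) p.23] -/
noncomputable def fromV (vc : A.fibreData.total.Vertex) :
    A.VModel vc ⥤ Over ((A.vComp vc).1 : 𝒢.V (A.fibreData.proj.vertexMap vc)) :=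
  (Shrink.equivalence (Over ((A.vComp vc).1 : 𝒢.V (A.fibreData.proj.vertexMap vc)))).inverse

/-- `Over Q ⥤ (𝒢_A)_{(e,Q)}`: the equivalence onto the model. [cite: MochizukiSemiAnbd2006, Def. 2.2(i) p.23] -/
noncomputable def toE (ec : A.fibreData.total.Edge) :
    Over ((A.eComp ec).1 : 𝒢.E (A.fibreData.proj.edgeMap ec)) ⥤ A.EModel ec :=
  (Shrink.equivalence (Over ((A.eComp ec).1 : 𝒢.E (A.fibreData.proj.edgeMap ec)))).functor

/-- `Over Q ⥤ (𝒢_A)_{(e,Q)}` for the component `Q` named by a BRANCH `(b, Q)` (indexed over the edge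
`e ∋ b`; definitionally `toE (edgeOf (b, Q))`). [cite: MochizukiSemiAnbd2006, Def. 2.2(i) p.23] -/
noncomputable def toBr (bc : A.fibreData.total.Branch) :
    Over ((A.brComp bc).1 : 𝒢.E (𝒢.graph.edgeOf (A.fibreData.proj.branchMap bc))) ⥤
      Shrink.{u₁} (Over ((A.brComp bc).1 : 𝒢.E (𝒢.graph.edgeOf (A.fibreData.proj.branchMap bc)))) :=
  (Shrink.equivalence (Over ((A.brComp bc).1 : 𝒢.E (𝒢.graph.edgeOf (A.fibreData.proj.branchMap bc))))).functor

/-- The gluing functor of `𝒢_A` along a branch `(b, Q)` abutting to `(v, P)`, on the component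
anabelioids: `X ↦ b^* X ×_{b^* P} Q`. [cite: MochizukiSemiAnbd2006, Def. 2.2(i) p.23] -/
noncomputable def gluingAt (bc : A.fibreData.total.Branch) (vc : A.fibreData.total.Vertex)
    (h : A.fibreData.total.abuts bc = some vc) :
    Over ((A.vComp vc).1 : 𝒢.V (A.fibreData.proj.vertexMap vc)) ⥤
      Over ((A.brComp bc).1 : 𝒢.E (𝒢.graph.edgeOf (A.fibreData.proj.branchMap bc))) :=
  A.gluingFunctor (abuts_fst h) (A.vComp vc).1 (A.brComp bc).1 (brComp_le_branchImage h)

/-- The pull-back functor of the gluing morphism of `𝒢_A` is the gluing functor conjugated into the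
models. [cite: MochizukiSemiAnbd2006, Def. 2.2(i) p.23] -/
theorem coveringGraph_pull_pullback (bc : A.fibreData.total.Branch) (vc : A.fibreData.total.Vertex)
    (h : A.fibreData.total.abuts bc = some vc) :
    (A.coveringGraph.pull bc vc h).pullback = A.fromV vc ⋙ A.gluingAt bc vc h ⋙ A.toBr bc := rfl

/-! ### Functors into `B(𝒢_A)` through the component anabelioids -/

section Lift

variable {K : Type w} [Category.{w'} K]

/-- A functor `K ⥤ B(𝒢_A)` from functors `K ⥤ Over P`, `K ⥤ Over Q` into the component anabelioids
and natural gluing isomorphisms along the gluing functors `X ↦ b^* X ×_{b^* P} Q` (the models are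
inserted here, once). [cite: MochizukiSemiAnbd2006, Def. 2.2(i) p.23] -/
noncomputable def liftOver (FV : ∀ vc : A.fibreData.total.Vertex, K ⥤ Over ((A.vComp vc).1 : 𝒢.V (A.fibreData.proj.vertexMap vc)))
    (FE : ∀ ec : A.fibreData.total.Edge, K ⥤ Over ((A.eComp ec).1 : 𝒢.E (A.fibreData.proj.edgeMap ec)))
    (glue : ∀ (bc : A.fibreData.total.Branch) (vc : A.fibreData.total.Vertex)
      (h : A.fibreData.total.abuts bc = some vc),
      FV vc ⋙ A.gluingAt bc vc h ≅ FE (A.fibreData.total.edgeOf bc)) :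
    K ⥤ A.coveringGraph.BObj :=
  BObj.lift (fun vc => FV vc ⋙ A.toV vc) (fun ec => FE ec ⋙ A.toE ec)
    (fun bc vc h =>
      show (FV vc ⋙ A.toV vc) ⋙ (A.fromV vc ⋙ A.gluingAt bc vc h ⋙ A.toBr bc) ≅
          FE (A.fibreData.total.edgeOf bc) ⋙ A.toBr bc from
        Functor.isoWhiskerLeft (FV vc)
            (Functor.isoWhiskerRight
              (Shrink.equivalence (Over ((A.vComp vc).1 : 𝒢.V (A.fibreData.proj.vertexMap vc)))).unitIso.symm
              (A.gluingAt bc vc h ⋙ A.toBr bc)) ≪≫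
          Functor.isoWhiskerRight (glue bc vc h) (A.toBr bc))

/-- Vertex objects of a lifted functor. [cite: MochizukiSemiAnbd2006, Def. 2.2(i) p.23] -/
@[simp] theorem liftOver_obj_S (FV : ∀ vc : A.fibreData.total.Vertex, K ⥤ Over ((A.vComp vc).1 : 𝒢.V (A.fibreData.proj.vertexMap vc)))
    (FE : ∀ ec : A.fibreData.total.Edge, K ⥤ Over ((A.eComp ec).1 : 𝒢.E (A.fibreData.proj.edgeMap ec)))
    (glue : ∀ (bc : A.fibreData.total.Branch) (vc : A.fibreData.total.Vertex)
      (h : A.fibreData.total.abuts bc = some vc),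
      FV vc ⋙ A.gluingAt bc vc h ≅ FE (A.fibreData.total.edgeOf bc)) (k : K)
    (vc : A.fibreData.total.Vertex) :
    ((A.liftOver FV FE glue).obj k).S vc = (A.toV vc).obj ((FV vc).obj k) := rfl

/-- Edge objects of a lifted functor. [cite: MochizukiSemiAnbd2006, Def. 2.2(i) p.23] -/
@[simp] theorem liftOver_obj_T (FV : ∀ vc : A.fibreData.total.Vertex, K ⥤ Over ((A.vComp vc).1 : 𝒢.V (A.fibreData.proj.vertexMap vc)))
    (FE : ∀ ec : A.fibreData.total.Edge, K ⥤ Over ((A.eComp ec).1 : 𝒢.E (A.fibreData.proj.edgeMap ec)))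
    (glue : ∀ (bc : A.fibreData.total.Branch) (vc : A.fibreData.total.Vertex)
      (h : A.fibreData.total.abuts bc = some vc),
      FV vc ⋙ A.gluingAt bc vc h ≅ FE (A.fibreData.total.edgeOf bc)) (k : K)
    (ec : A.fibreData.total.Edge) :
    ((A.liftOver FV FE glue).obj k).T ec = (A.toE ec).obj ((FE ec).obj k) := rfl

/-- Gluing isomorphisms of a lifted functor: cancel `Over P ⥤ model ⥤ Over P`, then the given gluing,
inside the model. [cite: MochizukiSemiAnbd2006, Def. 2.2(i) p.23] -/
theorem liftOver_obj_ψ_hom (FV : ∀ vc : A.fibreData.total.Vertex, K ⥤ Over ((A.vComp vc).1 : 𝒢.V (A.fibreData.proj.vertexMap vc)))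
    (FE : ∀ ec : A.fibreData.total.Edge, K ⥤ Over ((A.eComp ec).1 : 𝒢.E (A.fibreData.proj.edgeMap ec)))
    (glue : ∀ (bc : A.fibreData.total.Branch) (vc : A.fibreData.total.Vertex)
      (h : A.fibreData.total.abuts bc = some vc),
      FV vc ⋙ A.gluingAt bc vc h ≅ FE (A.fibreData.total.edgeOf bc)) (k : K)
    (bc : A.fibreData.total.Branch) (vc : A.fibreData.total.Vertex)
    (h : A.fibreData.total.abuts bc = some vc) :
    (((A.liftOver FV FE glue).obj k).ψ bc vc h).hom =
      (A.gluingAt bc vc h ⋙ A.toBr bc).map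
          ((Shrink.equivalence (Over ((A.vComp vc).1 : 𝒢.V (A.fibreData.proj.vertexMap vc)))).unitInv.app
            ((FV vc).obj k)) ≫
        (A.toBr bc).map ((glue bc vc h).hom.app k) := rfl

/-- Vertex components of a lifted functor on morphisms. [cite: MochizukiSemiAnbd2006, Def. 2.2(i) p.23] -/
@[simp] theorem liftOver_map_fS (FV : ∀ vc : A.fibreData.total.Vertex, K ⥤ Over ((A.vComp vc).1 : 𝒢.V (A.fibreData.proj.vertexMap vc)))
    (FE : ∀ ec : A.fibreData.total.Edge, K ⥤ Over ((A.eComp ec).1 : 𝒢.E (A.fibreData.proj.edgeMap ec)))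
    (glue : ∀ (bc : A.fibreData.total.Branch) (vc : A.fibreData.total.Vertex)
      (h : A.fibreData.total.abuts bc = some vc),
      FV vc ⋙ A.gluingAt bc vc h ≅ FE (A.fibreData.total.edgeOf bc)) {k k' : K} (f : k ⟶ k')
    (vc : A.fibreData.total.Vertex) :
    ((A.liftOver FV FE glue).map f).fS vc = (A.toV vc).map ((FV vc).map f) := rfl

/-- Edge components of a lifted functor on morphisms. [cite: MochizukiSemiAnbd2006, Def. 2.2(i) p.23] -/
@[simp] theorem liftOver_map_fT (FV : ∀ vc : A.fibreData.total.Vertex, K ⥤ Over ((A.vComp vc).1 : 𝒢.V (A.fibreData.proj.vertexMap vc)))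
    (FE : ∀ ec : A.fibreData.total.Edge, K ⥤ Over ((A.eComp ec).1 : 𝒢.E (A.fibreData.proj.edgeMap ec)))
    (glue : ∀ (bc : A.fibreData.total.Branch) (vc : A.fibreData.total.Vertex)
      (h : A.fibreData.total.abuts bc = some vc),
      FV vc ⋙ A.gluingAt bc vc h ≅ FE (A.fibreData.total.edgeOf bc)) {k k' : K} (f : k ⟶ k')
    (ec : A.fibreData.total.Edge) :
    ((A.liftOver FV FE glue).map f).fT ec = (A.toE ec).map ((FE ec).map f) := rfl

/-- **Isomorphisms of lifted functors from compatible component isomorphisms** — the compatibility is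
checked in the component anabelioids `Over P`, `Over Q`, not in the models.
[cite: MochizukiSemiAnbd2006, Def. 2.2(i) p.23] -/
noncomputable def liftOverIso
    {FV FV' : ∀ vc : A.fibreData.total.Vertex, K ⥤ Over ((A.vComp vc).1 : 𝒢.V (A.fibreData.proj.vertexMap vc))}
    {FE FE' : ∀ ec : A.fibreData.total.Edge, K ⥤ Over ((A.eComp ec).1 : 𝒢.E (A.fibreData.proj.edgeMap ec))}
    {glue : ∀ (bc : A.fibreData.total.Branch) (vc : A.fibreData.total.Vertex)
      (h : A.fibreData.total.abuts bc = some vc),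
      FV vc ⋙ A.gluingAt bc vc h ≅ FE (A.fibreData.total.edgeOf bc)}
    {glue' : ∀ (bc : A.fibreData.total.Branch) (vc : A.fibreData.total.Vertex)
      (h : A.fibreData.total.abuts bc = some vc),
      FV' vc ⋙ A.gluingAt bc vc h ≅ FE' (A.fibreData.total.edgeOf bc)}
    (ηV : ∀ vc, FV vc ≅ FV' vc) (ηE : ∀ ec, FE ec ≅ FE' ec)
    (comm : ∀ (bc : A.fibreData.total.Branch) (vc : A.fibreData.total.Vertex)
      (h : A.fibreData.total.abuts bc = some vc) (k : K),
      (A.gluingAt bc vc h).map ((ηV vc).hom.app k) ≫ (glue' bc vc h).hom.app k =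
        (glue bc vc h).hom.app k ≫ (ηE (A.fibreData.total.edgeOf bc)).hom.app k) :
    A.liftOver FV FE glue ≅ A.liftOver FV' FE' glue' :=
  BObj.natIsoOfComponents (fun vc => Functor.isoWhiskerRight (ηV vc) (A.toV vc))
    (fun ec => Functor.isoWhiskerRight (ηE ec) (A.toE ec)) (fun bc vc h k => by
      change A.fibreData.total.Branch at bc
      change A.fibreData.total.Vertex at vc
      change A.fibreData.total.abuts bc = some vc at h
      -- everything happens inside `toBr ∘ gluingAt`, after cancelling `toV ⋙ fromV` by the unit
      have hnat : (A.fromV vc).map ((A.toV vc).map ((ηV vc).hom.app k)) ≫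
          (Shrink.equivalence (Over ((A.vComp vc).1 : 𝒢.V (A.fibreData.proj.vertexMap vc)))).unitInv.app
            ((FV' vc).obj k) =
          (Shrink.equivalence (Over ((A.vComp vc).1 : 𝒢.V (A.fibreData.proj.vertexMap vc)))).unitInv.app
            ((FV vc).obj k) ≫ (ηV vc).hom.app k :=
        (Shrink.equivalence (Over ((A.vComp vc).1 : 𝒢.V (A.fibreData.proj.vertexMap vc)))).unitInv.naturality
          ((ηV vc).hom.app k)
      change (A.toBr bc).map ((A.gluingAt bc vc h).map ((A.fromV vc).map ((A.toV vc).map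
          ((ηV vc).hom.app k)))) ≫
        (A.toBr bc).map ((A.gluingAt bc vc h).map
          ((Shrink.equivalence (Over ((A.vComp vc).1 : 𝒢.V (A.fibreData.proj.vertexMap vc)))).unitInv.app
            ((FV' vc).obj k))) ≫
          (A.toBr bc).map ((glue' bc vc h).hom.app k) =
        ((A.toBr bc).map ((A.gluingAt bc vc h).map
          ((Shrink.equivalence (Over ((A.vComp vc).1 : 𝒢.V (A.fibreData.proj.vertexMap vc)))).unitInv.app
            ((FV vc).obj k))) ≫
          (A.toBr bc).map ((glue bc vc h).hom.app k)) ≫ (A.toBr bc).map ((ηE _).hom.app k)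
      rw [← Functor.map_comp, ← Functor.map_comp, ← Functor.map_comp_assoc, hnat, Functor.map_comp_assoc,
        comm bc vc h k, Category.assoc, ← Functor.map_comp, ← Functor.map_comp])

end Lift

end BObj

end SemiGraphOfAnabelioids

end Literature.AnabelianGeometry.SemiGraphs
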